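import Literature.MathematicalPhysics.QuantumFieldTheory.Balaban1983to89.B9Eq3101ConjugationLettersCoCurl
import Literature.MathematicalPhysics.QuantumFieldTheory.Balaban1983to89.B9Eq3101ConjugationLettersTwoBackgrounds

/-!
# `Balaban1983to89.B9Eq3101ConjugationLettersTwoBackgroundsAdjoint` — T. Bałaban, *Propagators for lattice gauge theories in a background field*, Commun.
# Math. Phys. **99** (1985) 389–434 [Balaban1985BackgroundPropagators] (3.3) pp. 390–391, (3.9) p. 392, (3.49) p. 399, (3.52)–(3.53) p. 400, (3.70)–(3.73)
# pp. 404–405, (3.101)–(3.103) p. 414: **THE CONJUGATED TWO-BACKGROUND LETTERS OF THE ADJOINT SIDES — THE COCURL AND THE GRADIENT: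
# `‖e^{κχ}(D*^{curl}_S − D*^{curl}_{S′})e^{−κχ}F‖ ≤ 2‖c‖·e^{‖κ‖θ}·δ_T·(d√d)·‖F‖`, `‖e^{κχ}(D_R − D_{R′})e^{−κχ}f‖ ≤ ‖c‖·e^{‖κ‖θ}·δ_T·√d·‖f‖`** — the
# `B′_{1,κ}` (cocurl) and `B′_{2,κ}` (gradient) companions of `B9Eq3101ConjugationLettersTwoBackgrounds` (curl ∕ divergence): zeroth order, NO window
# on `κ`

statement-level skeleton of published theorems with citation tags; proofs where landed; nothing here is a claim about the Yang–Mills mass gap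

CITATION HEADER (lean-in-tree rule).  Audit cell `pub-balaban`, sub-cell `t4`, BINDER row NE9; filed by NE9 formalisation-swarm LEAF PROVER 01
(`b2b-balaban-t4-ne9-formalise-leaf-01`, gen 88) under the fallback offer O-leaf01-g88-2 (cell journal 2026-08-25), as the lattice suppliers of the
CONJUGATED two-background difference letters `tB₁′`, `tB₂′` (the adjoint sides `B′_{1,κ} = S∘cocurl∘S_P⁻¹`, `B′_{2,κ} = S∘D∘S_S⁻¹` of (CDT)
`B9Eq326ConjugatedDeltaATower.conjDeltaAk_apply`) displayed by this lineage's `B9Eq326ConjugatedDeltaATwoBackgrounds.norm_conjGk_sub_conjGk_le` (t4-ne9-idea-1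
gen 151's N52 §2 (B)(ii)).  Imports the NE9 owner's
`B9Eq3101ConjugationLettersCoCurl` (the one-background cocurl pattern, `sum_site_pair_unshift_eq`) and `B9Eq3101ConjugationLettersTwoBackgrounds`
(`norm_exp_mul_le_of_abs_le`).  Sources READ first-hand in the held text layer (`paper:balaban1985-cmp99-background-propagators`, journal page = PDF page + 388):
pp. 390–391 (3.3), p. 392 (3.9), p. 399 (3.49), p. 400 (3.52)–(3.53), pp. 404–405 (3.70)–(3.73), p. 414 (3.101)–(3.103).  The conjugation is the ROUTE's
Combes–Thomas substitute; nothing of print is asserted.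

WHAT IS PROVED (sorry-free; proof lane — no `def`; [folklore] lattice bookkeeping).  Transporter data `S, S′` (resp. `R, R′`) with `‖S(b)v − S′(b)v‖ ≤ δ_T‖v‖`,
a weight `χ` with bond increments `|χ(b₋) − χ(b₊)| ≤ θ`, any `κ : ℂ`, any scalar `c`.
* §1 cocurl (3.9): `conj_covCoCurl_sub_covCoCurl_apply` (the untransported `F(y,q)` terms CANCEL in the difference, for ANY weights), `norm_term_sub_le`,
  `norm_conjExp_covCoCurl_sub_covCoCurl_apply_le`, `sum_norm_sq_conjExp_covCoCurl_sub_covCoCurl_le`,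
  **`norm_mulOp_covCoCurlL2K_sub_covCoCurlL2K_le`** (`‖S_B(D*_S(S_P⁻¹F)) − S_B(D*_{S′}(S_P⁻¹F))‖ ≤ 2‖c‖e^{‖κ‖θ}δ_T·(d√d)·‖F‖`).
* §2 gradient (3.3): `conj_covDeriv_sub_covDeriv_apply`, `norm_conjExp_covDeriv_sub_covDeriv_apply_le`, `sum_norm_sq_conjExp_covDeriv_sub_covDeriv_le`,
  **`norm_mulOp_covDerivL2K_sub_covDerivL2K_le`** (`‖S_B(D_R(S_S⁻¹f)) − S_B(D_{R′}(S_S⁻¹f))‖ ≤ ‖c‖e^{‖κ‖θ}δ_T·√d·‖f‖`).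
HONEST SCOPE.  Bookkeeping; `δ_T` displayed (`2M_φM_φ′·δη` on the chain); NO window on `κ`; the `Q`, `R(U)`, `Δ′` conjugated two-background letters are NOT
here.  NOT NE9 (cell pub-balaban: NE9 NOT PRINTED ∕ NOT PROVED; «NE9 ⇐ the named binders»; row WALLED ON A MODEL (O-NE9-1; #5 UNRULED); spine PROVED 0∕9;
rung (B)+1 on a finite T⁴ — NOT infinite volume, NOT mass gap, NOT BetaPertH, NOT Clay).  HONEST DEPENDENCY (cell line): continuum YM on T⁴ ⇐ BetaPertH ∧
nine spine estimates (0/9 proved); BetaPertH ⇐ (D1) ∧ (D4) ∧ CAP+tail; G-an2-4 gates asym, D1 and NE2/3/4.  NEW file; nothing modified.  Net new unproved facts: 0.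
-/

noncomputable section

open scoped BigOperators
open Finset

namespace Literature.MathematicalPhysics.QuantumFieldTheory.Balaban1983to89.B9Eq3101ConjugationLettersTwoBackgroundsAdjoint

open B4Sect5Torus (TSite)
open B9SectCLatticeCarrier (Bond DirPair bpos btgt shift unshift shift_unshift unshift_shift)
open B9Eq33CovDerivVector (covDeriv covDeriv_apply shiftEquiv)
open B9Eq34CovCurlVector (covCoCurl covCoCurl_apply)
open B9Eq311L2Pairing (WL2)
open B11Eq103H1Complex (SiteL2K BondL2K covDerivL2K)
open B9Eq310HessianOperator (PlaqL2K covCoCurlL2K equiv_covCoCurlL2K)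
open B9Eq373DerivativeRemainderL2 (sum_bond_btgt)
open B9Eq3101ConjugationLetters (exp_mul_exp_neg_eq_exp_sub)
open B9Eq3101ConjugationLettersCoCurl (sum_site_pair_unshift_eq)
open B9Eq3101ConjugationLettersTwoBackgrounds (norm_exp_mul_le_of_abs_le)

variable {d : ℕ} {Pd : Fin d → ℕ} {V : Type*} [NormedAddCommGroup V] [NormedSpace ℂ V]

/-! ## §1 The cocurl (3.9): the difference of two covariant cocurls, conjugated -/

/-- **IDENTITY** for the cocurl (3.9): for ANY weights `σ, ρ` the untransported `F(y,q)` terms cancel in the difference and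
`σ(y)((D*_S − D*_{S′})(ρF))(y,κ) = c·[Σ_{q₂=κ} σ(y)ρ(y−e_{q₁})(S − S′)(y−e_{q₁},q₁)F(y−e_{q₁},q) − Σ_{q₁=κ} σ(y)ρ(y−e_{q₂})(S − S′)(y−e_{q₂},q₂)F(y−e_{q₂},q)]`.
[folklore] [cite: Balaban1985BackgroundPropagators, (3.9) p.392, (3.70) p.404] -/
theorem conj_covCoCurl_sub_covCoCurl_apply (σ ρ : TSite d Pd → ℂ) (c : ℂ) (S S' : Bond d Pd → V →ₗ[ℂ] V)
    (F : B9SectCLatticeCarrier.Plaq d Pd → V) (y : TSite d Pd) (κ : Fin d) :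
    σ y • covCoCurl c S (fun p => ρ p.1 • F p) (y, κ) - σ y • covCoCurl c S' (fun p => ρ p.1 • F p) (y, κ) =
      c • ((∑ q ∈ univ.filter (fun q : DirPair d => q.1.2 = κ),
          (σ y * ρ (unshift q.1.1 y)) • (S (unshift q.1.1 y, q.1.1) - S' (unshift q.1.1 y, q.1.1)) (F (unshift q.1.1 y, q))) -
        ∑ q ∈ univ.filter (fun q : DirPair d => q.1.1 = κ),
          (σ y * ρ (unshift q.1.2 y)) • (S (unshift q.1.2 y, q.1.2) - S' (unshift q.1.2 y, q.1.2)) (F (unshift q.1.2 y, q))) := by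
  rw [covCoCurl_apply, covCoCurl_apply, smul_comm (σ y) c, smul_comm (σ y) c, ← smul_sub, smul_sub (σ y), smul_sub (σ y), Finset.smul_sum,
    Finset.smul_sum, Finset.smul_sum, Finset.smul_sum]
  congr 1
  rw [sub_sub_sub_comm, ← Finset.sum_sub_distrib, ← Finset.sum_sub_distrib]
  congr 1
  · refine Finset.sum_congr rfl fun q _ => ?_
    simp only [map_smul, smul_sub, smul_smul, LinearMap.sub_apply]
    module
  · refine Finset.sum_congr rfl fun q _ => ?_
    simp only [map_smul, smul_sub, smul_smul, LinearMap.sub_apply]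
    module

/-- One transported difference term: `‖e^{κ(χ(y)−χ(y−e_ν))}·(S − S′)(y−e_ν,ν)v‖ ≤ e^{‖κ‖θ}δ_T‖v‖`. [folklore]
[cite: Balaban1985BackgroundPropagators, (3.49) p.399, (3.70)–(3.73) pp.404–405] -/
theorem norm_term_sub_le {θ δT : ℝ} {S S' : Bond d Pd → V →ₗ[ℂ] V} (hSS' : ∀ b v, ‖S b v - S' b v‖ ≤ δT * ‖v‖) (κc : ℂ) {χ : TSite d Pd → ℝ}
    (hχ : ∀ b : Bond d Pd, |χ (bpos b) - χ (btgt b)| ≤ θ) (y : TSite d Pd) (ν : Fin d) (v : V) :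
    ‖(Complex.exp (κc * (χ y : ℂ)) * Complex.exp (-(κc * (χ (unshift ν y) : ℂ)))) • (S (unshift ν y, ν) - S' (unshift ν y, ν)) v‖ ≤
      Real.exp (‖κc‖ * θ) * δT * ‖v‖ := by
  rw [exp_mul_exp_neg_eq_exp_sub, norm_smul, LinearMap.sub_apply]
  have hinc : |χ y - χ (unshift ν y)| ≤ θ := by
    rw [abs_sub_comm]
    have h := hχ (unshift ν y, ν)
    simp only [bpos, btgt, shift_unshift] at h
    exact h
  have h1 : ‖Complex.exp (κc * ((χ y - χ (unshift ν y) : ℝ) : ℂ))‖ ≤ Real.exp (‖κc‖ * θ) := norm_exp_mul_le_of_abs_le κc hinc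
  calc _ ≤ Real.exp (‖κc‖ * θ) * (δT * ‖v‖) := mul_le_mul h1 (hSS' _ _) (norm_nonneg _) (Real.exp_pos _).le
    _ = Real.exp (‖κc‖ * θ) * δT * ‖v‖ := by ring

/-- **POINTWISE BOUND** for the cocurl difference (the ordered-pair sums bounded by the full sums over `q`):
`‖e^{κχ(y)}((D*_S − D*_{S′})(e^{−κχ}F))(y,κ)‖ ≤ ‖c‖e^{‖κ‖θ}δ_T·(Σ_q ‖F(y−e_{q₁},q)‖ + Σ_q ‖F(y−e_{q₂},q)‖)`. [folklore]
[cite: Balaban1985BackgroundPropagators, (3.9) p.392, (3.49) p.399, (3.70)–(3.73) pp.404–405] -/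
theorem norm_conjExp_covCoCurl_sub_covCoCurl_apply_le {θ δT : ℝ} (hδT : 0 ≤ δT) {S S' : Bond d Pd → V →ₗ[ℂ] V}
    (hSS' : ∀ b v, ‖S b v - S' b v‖ ≤ δT * ‖v‖) (κc : ℂ) {χ : TSite d Pd → ℝ} (hχ : ∀ b : Bond d Pd, |χ (bpos b) - χ (btgt b)| ≤ θ)
    (c : ℂ) (F : B9SectCLatticeCarrier.Plaq d Pd → V) (y : TSite d Pd) (κ : Fin d) :
    ‖Complex.exp (κc * (χ y : ℂ)) • covCoCurl c S (fun p => Complex.exp (-(κc * (χ p.1 : ℂ))) • F p) (y, κ) -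
        Complex.exp (κc * (χ y : ℂ)) • covCoCurl c S' (fun p => Complex.exp (-(κc * (χ p.1 : ℂ))) • F p) (y, κ)‖ ≤
      ‖c‖ * Real.exp (‖κc‖ * θ) * δT * ((∑ q : DirPair d, ‖F (unshift q.1.1 y, q)‖) + ∑ q : DirPair d, ‖F (unshift q.1.2 y, q)‖) := by
  rw [conj_covCoCurl_sub_covCoCurl_apply (fun x => Complex.exp (κc * (χ x : ℂ))) (fun x => Complex.exp (-(κc * (χ x : ℂ)))) c S S' F y κ, norm_smul]
  set K' : ℝ := Real.exp (‖κc‖ * θ) * δT with hK'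
  have hK'0 : 0 ≤ K' := by positivity
  have h1 : ‖∑ q ∈ univ.filter (fun q : DirPair d => q.1.2 = κ),
      (Complex.exp (κc * (χ y : ℂ)) * Complex.exp (-(κc * (χ (unshift q.1.1 y) : ℂ)))) •
        (S (unshift q.1.1 y, q.1.1) - S' (unshift q.1.1 y, q.1.1)) (F (unshift q.1.1 y, q))‖ ≤ K' * ∑ q : DirPair d, ‖F (unshift q.1.1 y, q)‖ := by
    calc _ ≤ ∑ q ∈ univ.filter (fun q : DirPair d => q.1.2 = κ), K' * ‖F (unshift q.1.1 y, q)‖ :=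
          (norm_sum_le _ _).trans (Finset.sum_le_sum fun q _ => norm_term_sub_le hSS' κc hχ y q.1.1 _)
      _ ≤ ∑ q : DirPair d, K' * ‖F (unshift q.1.1 y, q)‖ :=
          Finset.sum_le_sum_of_subset_of_nonneg (Finset.filter_subset _ _) fun q _ _ => by positivity
      _ = K' * ∑ q : DirPair d, ‖F (unshift q.1.1 y, q)‖ := by rw [Finset.mul_sum]
  have h2 : ‖∑ q ∈ univ.filter (fun q : DirPair d => q.1.1 = κ),
      (Complex.exp (κc * (χ y : ℂ)) * Complex.exp (-(κc * (χ (unshift q.1.2 y) : ℂ)))) •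
        (S (unshift q.1.2 y, q.1.2) - S' (unshift q.1.2 y, q.1.2)) (F (unshift q.1.2 y, q))‖ ≤ K' * ∑ q : DirPair d, ‖F (unshift q.1.2 y, q)‖ := by
    calc _ ≤ ∑ q ∈ univ.filter (fun q : DirPair d => q.1.1 = κ), K' * ‖F (unshift q.1.2 y, q)‖ :=
          (norm_sum_le _ _).trans (Finset.sum_le_sum fun q _ => norm_term_sub_le hSS' κc hχ y q.1.2 _)
      _ ≤ ∑ q : DirPair d, K' * ‖F (unshift q.1.2 y, q)‖ :=
          Finset.sum_le_sum_of_subset_of_nonneg (Finset.filter_subset _ _) fun q _ _ => by positivity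
      _ = K' * ∑ q : DirPair d, ‖F (unshift q.1.2 y, q)‖ := by rw [Finset.mul_sum]
  calc _ ≤ ‖c‖ * (K' * ∑ q : DirPair d, ‖F (unshift q.1.1 y, q)‖ + K' * ∑ q : DirPair d, ‖F (unshift q.1.2 y, q)‖) :=
        mul_le_mul_of_nonneg_left ((norm_sub_le _ _).trans (add_le_add h1 h2)) (norm_nonneg c)
    _ = ‖c‖ * Real.exp (‖κc‖ * θ) * δT * ((∑ q : DirPair d, ‖F (unshift q.1.1 y, q)‖) + ∑ q : DirPair d, ‖F (unshift q.1.2 y, q)‖) := by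
        rw [hK']; ring

/-- `|DirPair d| ≤ d²`. [folklore] [cite: Balaban1985BackgroundPropagators, (3.9) p.392] -/
private theorem card_dirPair_le' : (Fintype.card (DirPair d) : ℝ) ≤ (d : ℝ) ^ 2 := by
  have h : Fintype.card (DirPair d) ≤ Fintype.card (Fin d × Fin d) := Fintype.card_subtype_le _
  rw [Fintype.card_prod, Fintype.card_fin] at h
  calc (Fintype.card (DirPair d) : ℝ) ≤ ((d * d : ℕ) : ℝ) := by exact_mod_cast h
    _ = (d : ℝ) ^ 2 := by push_cast; ring

/-- **`ℓ²` BOUND, function level:** `Σ_b ‖e^{κχ}((D*_S − D*_{S′})(e^{−κχ}F))(b)‖² ≤ 4(‖c‖e^{‖κ‖θ}δ_T)²·d³·Σ_p ‖F(p)‖²`. [folklore]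
[cite: Balaban1985BackgroundPropagators, (3.9) p.392, (3.49) p.399, (3.70)–(3.73) pp.404–405] -/
theorem sum_norm_sq_conjExp_covCoCurl_sub_covCoCurl_le {θ δT : ℝ} (hδT : 0 ≤ δT) {S S' : Bond d Pd → V →ₗ[ℂ] V}
    (hSS' : ∀ b v, ‖S b v - S' b v‖ ≤ δT * ‖v‖) (κc : ℂ) {χ : TSite d Pd → ℝ} (hχ : ∀ b : Bond d Pd, |χ (bpos b) - χ (btgt b)| ≤ θ)
    (c : ℂ) (F : B9SectCLatticeCarrier.Plaq d Pd → V) :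
    ∑ b : Bond d Pd, ‖Complex.exp (κc * (χ b.1 : ℂ)) • covCoCurl c S (fun p => Complex.exp (-(κc * (χ p.1 : ℂ))) • F p) b -
        Complex.exp (κc * (χ b.1 : ℂ)) • covCoCurl c S' (fun p => Complex.exp (-(κc * (χ p.1 : ℂ))) • F p) b‖ ^ 2
      ≤ 4 * (‖c‖ * Real.exp (‖κc‖ * θ) * δT) ^ 2 * (d : ℝ) ^ 3 * ∑ p : B9SectCLatticeCarrier.Plaq d Pd, ‖F p‖ ^ 2 := by
  set K : ℝ := ‖c‖ * Real.exp (‖κc‖ * θ) * δT with hK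
  set N : ℝ := (Fintype.card (DirPair d) : ℝ) with hN
  set A : TSite d Pd → ℝ := fun y => ∑ q : DirPair d, ‖F (unshift q.1.1 y, q)‖ with hA
  set B : TSite d Pd → ℝ := fun y => ∑ q : DirPair d, ‖F (unshift q.1.2 y, q)‖ with hB
  have hpt : ∀ b : Bond d Pd, ‖Complex.exp (κc * (χ b.1 : ℂ)) • covCoCurl c S (fun p => Complex.exp (-(κc * (χ p.1 : ℂ))) • F p) b -
      Complex.exp (κc * (χ b.1 : ℂ)) • covCoCurl c S' (fun p => Complex.exp (-(κc * (χ p.1 : ℂ))) • F p) b‖ ^ 2 ≤ 2 * K ^ 2 * (A b.1 ^ 2 + B b.1 ^ 2) := by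
    rintro ⟨y, κ⟩
    have h := norm_conjExp_covCoCurl_sub_covCoCurl_apply_le hδT hSS' κc hχ c F y κ
    calc _ ≤ (K * (A y + B y)) ^ 2 := pow_le_pow_left₀ (norm_nonneg _) h 2
      _ ≤ 2 * K ^ 2 * (A y ^ 2 + B y ^ 2) := by nlinarith [sq_nonneg (A y - B y), sq_nonneg K]
  have hcsA : ∀ y, A y ^ 2 ≤ N * ∑ q : DirPair d, ‖F (unshift q.1.1 y, q)‖ ^ 2 := fun y => by
    have h := sq_sum_le_card_mul_sum_sq (s := (univ : Finset (DirPair d))) (f := fun q => ‖F (unshift q.1.1 y, q)‖)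
    rwa [Finset.card_univ] at h
  have hcsB : ∀ y, B y ^ 2 ≤ N * ∑ q : DirPair d, ‖F (unshift q.1.2 y, q)‖ ^ 2 := fun y => by
    have h := sq_sum_le_card_mul_sum_sq (s := (univ : Finset (DirPair d))) (f := fun q => ‖F (unshift q.1.2 y, q)‖)
    rwa [Finset.card_univ] at h
  have hSA := sum_site_pair_unshift_eq (fun p => ‖F p‖ ^ 2) (fun q : DirPair d => q.1.1)
  have hSB := sum_site_pair_unshift_eq (fun p => ‖F p‖ ^ 2) (fun q : DirPair d => q.1.2)
  have hNle : N ≤ (d : ℝ) ^ 2 := card_dirPair_le'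
  have hsum0 : 0 ≤ ∑ p : B9SectCLatticeCarrier.Plaq d Pd, ‖F p‖ ^ 2 := Finset.sum_nonneg fun p _ => sq_nonneg _
  calc _ ≤ ∑ b : Bond d Pd, 2 * K ^ 2 * (A b.1 ^ 2 + B b.1 ^ 2) := Finset.sum_le_sum fun b _ => hpt b
    _ = d * ∑ y : TSite d Pd, 2 * K ^ 2 * (A y ^ 2 + B y ^ 2) := by
        rw [Fintype.sum_prod_type]
        simp only [Finset.sum_const, Finset.card_univ, Fintype.card_fin, nsmul_eq_mul]
        rw [Finset.mul_sum]
    _ ≤ d * ∑ y : TSite d Pd, 2 * K ^ 2 * (N * (∑ q : DirPair d, ‖F (unshift q.1.1 y, q)‖ ^ 2) + N * ∑ q : DirPair d, ‖F (unshift q.1.2 y, q)‖ ^ 2) := by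
        gcongr with y
        · exact hcsA y
        · exact hcsB y
    _ = 2 * K ^ 2 * N * d * ((∑ y : TSite d Pd, ∑ q : DirPair d, ‖F (unshift q.1.1 y, q)‖ ^ 2) +
          ∑ y : TSite d Pd, ∑ q : DirPair d, ‖F (unshift q.1.2 y, q)‖ ^ 2) := by
        rw [← Finset.sum_add_distrib]
        conv_rhs => rw [Finset.mul_sum]
        conv_lhs => rw [Finset.mul_sum]
        exact Finset.sum_congr rfl fun y _ => by ring
    _ = 4 * K ^ 2 * N * d * ∑ p : B9SectCLatticeCarrier.Plaq d Pd, ‖F p‖ ^ 2 := by rw [hSA, hSB]; ring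
    _ ≤ 4 * K ^ 2 * (d : ℝ) ^ 2 * d * ∑ p : B9SectCLatticeCarrier.Plaq d Pd, ‖F p‖ ^ 2 := by gcongr
    _ = 4 * K ^ 2 * (d : ℝ) ^ 3 * ∑ p : B9SectCLatticeCarrier.Plaq d Pd, ‖F p‖ ^ 2 := by ring

/-! ## §2 The gradient (3.3): the difference of two covariant derivatives, conjugated -/

/-- **IDENTITY** for (3.3): for ANY weights the `f(b₋)` term cancels in the difference,
`σ(b₋)((D_R − D_{R′})(ρf))(b) = cσ(b₋)ρ(b₊)·(R − R′)(b)f(b₊)`. [folklore] [cite: Balaban1985BackgroundPropagators, (3.3) pp.390–391, (3.70) p.404] -/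
theorem conj_covDeriv_sub_covDeriv_apply (σ ρ : TSite d Pd → ℂ) (c : ℂ) (R R' : Bond d Pd → V →ₗ[ℂ] V) (f : TSite d Pd → V) (b : Bond d Pd) :
    σ (bpos b) • covDeriv c R (fun x => ρ x • f x) b - σ (bpos b) • covDeriv c R' (fun x => ρ x • f x) b =
      (c * (σ (bpos b) * ρ (btgt b))) • (R b - R' b) (f (btgt b)) := by
  simp only [covDeriv_apply, map_smul, smul_sub, smul_smul, LinearMap.sub_apply]
  module

/-- **POINTWISE BOUND** for (3.3): `‖e^{κχ(b₋)}((D_R − D_{R′})(e^{−κχ}f))(b)‖ ≤ ‖c‖e^{‖κ‖θ}δ_T·‖f(b₊)‖`. [folklore]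
[cite: Balaban1985BackgroundPropagators, (3.3) pp.390–391, (3.49) p.399, (3.70)–(3.73) pp.404–405] -/
theorem norm_conjExp_covDeriv_sub_covDeriv_apply_le {θ δT : ℝ} {R R' : Bond d Pd → V →ₗ[ℂ] V} (hRR' : ∀ b v, ‖R b v - R' b v‖ ≤ δT * ‖v‖)
    (κc : ℂ) {χ : TSite d Pd → ℝ} (hχ : ∀ b : Bond d Pd, |χ (bpos b) - χ (btgt b)| ≤ θ) (c : ℂ) (f : TSite d Pd → V) (b : Bond d Pd) :
    ‖Complex.exp (κc * (χ (bpos b) : ℂ)) • covDeriv c R (fun x => Complex.exp (-(κc * (χ x : ℂ))) • f x) b -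
        Complex.exp (κc * (χ (bpos b) : ℂ)) • covDeriv c R' (fun x => Complex.exp (-(κc * (χ x : ℂ))) • f x) b‖ ≤
      ‖c‖ * Real.exp (‖κc‖ * θ) * δT * ‖f (btgt b)‖ := by
  rw [conj_covDeriv_sub_covDeriv_apply (fun x => Complex.exp (κc * (χ x : ℂ))) (fun x => Complex.exp (-(κc * (χ x : ℂ)))) c R R' f b,
    exp_mul_exp_neg_eq_exp_sub, norm_smul, norm_mul, LinearMap.sub_apply]
  have h1 : ‖Complex.exp (κc * ((χ (bpos b) - χ (btgt b) : ℝ) : ℂ))‖ ≤ Real.exp (‖κc‖ * θ) := norm_exp_mul_le_of_abs_le κc (hχ b)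
  have h2 : ‖R b (f (btgt b)) - R' b (f (btgt b))‖ ≤ δT * ‖f (btgt b)‖ := hRR' b _
  calc ‖c‖ * ‖Complex.exp (κc * ((χ (bpos b) - χ (btgt b) : ℝ) : ℂ))‖ * ‖R b (f (btgt b)) - R' b (f (btgt b))‖
      ≤ ‖c‖ * Real.exp (‖κc‖ * θ) * (δT * ‖f (btgt b)‖) :=
        mul_le_mul (mul_le_mul_of_nonneg_left h1 (norm_nonneg c)) h2 (norm_nonneg _) (mul_nonneg (norm_nonneg c) (Real.exp_pos _).le)
    _ = ‖c‖ * Real.exp (‖κc‖ * θ) * δT * ‖f (btgt b)‖ := by ring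

/-- **`ℓ²` BOUND, function level:** `Σ_b ‖e^{κχ}((D_R − D_{R′})(e^{−κχ}f))(b)‖² ≤ (‖c‖e^{‖κ‖θ}δ_T)²·d·Σ_x ‖f x‖²` (every site is the tip of exactly `d`
bonds — `B9Eq373DerivativeRemainderL2.sum_bond_btgt`). [folklore] [cite: Balaban1985BackgroundPropagators, (3.3) pp.390–391, (3.49) p.399, (3.70)–(3.73) pp.404–405] -/
theorem sum_norm_sq_conjExp_covDeriv_sub_covDeriv_le {θ δT : ℝ} {R R' : Bond d Pd → V →ₗ[ℂ] V} (hRR' : ∀ b v, ‖R b v - R' b v‖ ≤ δT * ‖v‖)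
    (κc : ℂ) {χ : TSite d Pd → ℝ} (hχ : ∀ b : Bond d Pd, |χ (bpos b) - χ (btgt b)| ≤ θ) (c : ℂ) (f : TSite d Pd → V) :
    ∑ b : Bond d Pd, ‖Complex.exp (κc * (χ (bpos b) : ℂ)) • covDeriv c R (fun x => Complex.exp (-(κc * (χ x : ℂ))) • f x) b -
        Complex.exp (κc * (χ (bpos b) : ℂ)) • covDeriv c R' (fun x => Complex.exp (-(κc * (χ x : ℂ))) • f x) b‖ ^ 2
      ≤ (‖c‖ * Real.exp (‖κc‖ * θ) * δT) ^ 2 * d * ∑ x, ‖f x‖ ^ 2 := by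
  calc _ ≤ ∑ b : Bond d Pd, (‖c‖ * Real.exp (‖κc‖ * θ) * δT) ^ 2 * ‖f (btgt b)‖ ^ 2 := by
        refine sum_le_sum fun b _ => ?_
        have h := norm_conjExp_covDeriv_sub_covDeriv_apply_le hRR' κc hχ c f b
        calc _ ≤ (‖c‖ * Real.exp (‖κc‖ * θ) * δT * ‖f (btgt b)‖) ^ 2 := pow_le_pow_left₀ (norm_nonneg _) h 2
          _ = (‖c‖ * Real.exp (‖κc‖ * θ) * δT) ^ 2 * ‖f (btgt b)‖ ^ 2 := by ring
    _ = (‖c‖ * Real.exp (‖κc‖ * θ) * δT) ^ 2 * ∑ b : Bond d Pd, ‖f (btgt b)‖ ^ 2 := by rw [mul_sum]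
    _ = (‖c‖ * Real.exp (‖κc‖ * θ) * δT) ^ 2 * d * ∑ x, ‖f x‖ ^ 2 := by
        rw [sum_bond_btgt (fun x => ‖f x‖ ^ 2)]; ring

/-! ## §3 The letters on the weighted `L²` carriers, for abstract multiplication maps -/

section L2

variable {W : Type*} [NormedAddCommGroup W] [InnerProductSpace ℂ W] {c₀ : ℝ} [Fact (0 < c₀)]

/-- **THE CONJUGATED TWO-BACKGROUND COCURL LETTER** for ANY maps `S_B` (bond carrier, `e^{κχ(b₋)}`) and `S_P⁻¹` (plaquette carrier, `e^{−κχ(p₀)}`),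
transporter data `‖S(b)v − S′(b)v‖ ≤ δ_T‖v‖` (`0 ≤ δ_T`) and bond increments `|χ(b₋) − χ(b₊)| ≤ θ`:
`‖S_B(D*_S(S_P⁻¹F)) − S_B(D*_{S′}(S_P⁻¹F))‖ ≤ 2‖c‖·e^{‖κ‖θ}·δ_T·(d√d)·‖F‖` — the `tB₁′`-letter of `…norm_conjGk_sub_conjGk_le` at the lattice, NO window.
[folklore] [cite: Balaban1985BackgroundPropagators, (3.9) p.392, (3.49) p.399, (3.52)–(3.53) p.400, (3.70)–(3.73) pp.404–405] -/
theorem norm_mulOp_covCoCurlL2K_sub_covCoCurlL2K_le {θ δT : ℝ} (hδT : 0 ≤ δT) {S S' : Bond d Pd → W →ₗ[ℂ] W}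
    (hSS' : ∀ b v, ‖S b v - S' b v‖ ≤ δT * ‖v‖) {κc : ℂ} {χ : TSite d Pd → ℝ} (hχ : ∀ b : Bond d Pd, |χ (bpos b) - χ (btgt b)| ≤ θ) (c : ℂ)
    (SB : BondL2K ℂ d Pd c₀ W → BondL2K ℂ d Pd c₀ W)
    (hSB : ∀ (A : BondL2K ℂ d Pd c₀ W) (b : Bond d Pd),
      WL2.equiv ℂ (fun _ : Bond d Pd => c₀) W (SB A) b = Complex.exp (κc * (χ b.1 : ℂ)) • WL2.equiv ℂ (fun _ : Bond d Pd => c₀) W A b)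
    (SPinv : PlaqL2K ℂ d Pd c₀ W → PlaqL2K ℂ d Pd c₀ W)
    (hSPinv : ∀ (F : PlaqL2K ℂ d Pd c₀ W) (p : B9SectCLatticeCarrier.Plaq d Pd),
      WL2.equiv ℂ (fun _ : B9SectCLatticeCarrier.Plaq d Pd => c₀) W (SPinv F) p =
        Complex.exp (-(κc * (χ p.1 : ℂ))) • WL2.equiv ℂ (fun _ : B9SectCLatticeCarrier.Plaq d Pd => c₀) W F p)
    (F : PlaqL2K ℂ d Pd c₀ W) :
    ‖SB (covCoCurlL2K ℂ c₀ c S (SPinv F)) - SB (covCoCurlL2K ℂ c₀ c S' (SPinv F))‖ ≤ 2 * ‖c‖ * Real.exp (‖κc‖ * θ) * δT * (d * Real.sqrt d) * ‖F‖ := by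
  set K : ℝ := ‖c‖ * Real.exp (‖κc‖ * θ) * δT with hK
  have hK0 : 0 ≤ K := by positivity
  have hc₀ : 0 < c₀ := Fact.out
  set G : B9SectCLatticeCarrier.Plaq d Pd → W := WL2.equiv ℂ (fun _ : B9SectCLatticeCarrier.Plaq d Pd => c₀) W F with hG
  have hsum := sum_norm_sq_conjExp_covCoCurl_sub_covCoCurl_le hδT hSS' κc hχ c G
  have hd3 : (d : ℝ) ^ 3 = (d * Real.sqrt d) ^ 2 := by
    rw [mul_pow, Real.sq_sqrt (Nat.cast_nonneg d)]; ring
  have e : ∀ b : Bond d Pd,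
      WL2.equiv ℂ (fun _ : Bond d Pd => c₀) W (SB (covCoCurlL2K ℂ c₀ c S (SPinv F)) - SB (covCoCurlL2K ℂ c₀ c S' (SPinv F))) b =
        Complex.exp (κc * (χ b.1 : ℂ)) • covCoCurl c S (fun p => Complex.exp (-(κc * (χ p.1 : ℂ))) • G p) b -
          Complex.exp (κc * (χ b.1 : ℂ)) • covCoCurl c S' (fun p => Complex.exp (-(κc * (χ p.1 : ℂ))) • G p) b := by
    intro b
    have hp : (WL2.equiv ℂ (fun _ : B9SectCLatticeCarrier.Plaq d Pd => c₀) W (SPinv F)) = fun p => Complex.exp (-(κc * (χ p.1 : ℂ))) • G p :=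
      funext fun p => hSPinv F p
    rw [WL2.equiv_sub, Pi.sub_apply, hSB, hSB, equiv_covCoCurlL2K, equiv_covCoCurlL2K, hp]
  have hsq : ‖SB (covCoCurlL2K ℂ c₀ c S (SPinv F)) - SB (covCoCurlL2K ℂ c₀ c S' (SPinv F))‖ ^ 2 ≤ (2 * K * (d * Real.sqrt d) * ‖F‖) ^ 2 := by
    rw [WL2.norm_sq, mul_pow, mul_pow, mul_pow, ← hd3, WL2.norm_sq F]
    simp only [e]
    rw [← mul_sum, ← mul_sum]
    calc c₀ * ∑ b : Bond d Pd, ‖Complex.exp (κc * (χ b.1 : ℂ)) • covCoCurl c S (fun p => Complex.exp (-(κc * (χ p.1 : ℂ))) • G p) b -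
            Complex.exp (κc * (χ b.1 : ℂ)) • covCoCurl c S' (fun p => Complex.exp (-(κc * (χ p.1 : ℂ))) • G p) b‖ ^ 2
        ≤ c₀ * (4 * K ^ 2 * (d : ℝ) ^ 3 * ∑ p, ‖G p‖ ^ 2) := mul_le_mul_of_nonneg_left hsum hc₀.le
      _ = 2 ^ 2 * K ^ 2 * (d : ℝ) ^ 3 * (c₀ * ∑ p, ‖G p‖ ^ 2) := by ring
  have hR0 : 0 ≤ 2 * K * (d * Real.sqrt d) * ‖F‖ := by positivity
  calc _ ≤ 2 * K * (d * Real.sqrt d) * ‖F‖ := (pow_le_pow_iff_left₀ (norm_nonneg _) hR0 two_ne_zero).1 hsq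
    _ = 2 * ‖c‖ * Real.exp (‖κc‖ * θ) * δT * (d * Real.sqrt d) * ‖F‖ := by rw [hK]; ring

/-- **THE CONJUGATED TWO-BACKGROUND GRADIENT LETTER** for ANY maps `S_B` (bond carrier, `e^{κχ(b₋)}`) and `S_S⁻¹` (site carrier, `e^{−κχ(x)}`):
`‖S_B(D_R(S_S⁻¹f)) − S_B(D_{R′}(S_S⁻¹f))‖ ≤ ‖c‖·e^{‖κ‖θ}·δ_T·√d·‖f‖` — the `tB₂′`-letter of `…norm_conjGk_sub_conjGk_le` at the lattice, NO window.
[folklore] [cite: Balaban1985BackgroundPropagators, (3.3) pp.390–391, (3.49) p.399, (3.52)–(3.53) p.400, (3.70)–(3.73) pp.404–405] -/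
theorem norm_mulOp_covDerivL2K_sub_covDerivL2K_le {θ δT : ℝ} (hδT : 0 ≤ δT) {R R' : Bond d Pd → W →ₗ[ℂ] W}
    (hRR' : ∀ b v, ‖R b v - R' b v‖ ≤ δT * ‖v‖) {κc : ℂ} {χ : TSite d Pd → ℝ} (hχ : ∀ b : Bond d Pd, |χ (bpos b) - χ (btgt b)| ≤ θ) (c : ℂ)
    (SB : BondL2K ℂ d Pd c₀ W → BondL2K ℂ d Pd c₀ W)
    (hSB : ∀ (g : BondL2K ℂ d Pd c₀ W) (b : Bond d Pd),
      WL2.equiv ℂ (fun _ : Bond d Pd => c₀) W (SB g) b = Complex.exp (κc * (χ (bpos b) : ℂ)) • WL2.equiv ℂ (fun _ : Bond d Pd => c₀) W g b)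
    (SSinv : SiteL2K ℂ d Pd c₀ W → SiteL2K ℂ d Pd c₀ W)
    (hSSinv : ∀ (f : SiteL2K ℂ d Pd c₀ W) (x : TSite d Pd),
      WL2.equiv ℂ (fun _ : TSite d Pd => c₀) W (SSinv f) x = Complex.exp (-(κc * (χ x : ℂ))) • WL2.equiv ℂ (fun _ : TSite d Pd => c₀) W f x)
    (f : SiteL2K ℂ d Pd c₀ W) :
    ‖SB (covDerivL2K ℂ c₀ c R (SSinv f)) - SB (covDerivL2K ℂ c₀ c R' (SSinv f))‖ ≤ ‖c‖ * Real.exp (‖κc‖ * θ) * δT * Real.sqrt d * ‖f‖ := by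
  set K : ℝ := ‖c‖ * Real.exp (‖κc‖ * θ) * δT with hK
  have hK0 : 0 ≤ K := by positivity
  have hc₀ : 0 < c₀ := Fact.out
  set g : TSite d Pd → W := WL2.equiv ℂ (fun _ : TSite d Pd => c₀) W f with hg
  have hsum := sum_norm_sq_conjExp_covDeriv_sub_covDeriv_le hRR' κc hχ c g
  have e : ∀ b : Bond d Pd,
      WL2.equiv ℂ (fun _ : Bond d Pd => c₀) W (SB (covDerivL2K ℂ c₀ c R (SSinv f)) - SB (covDerivL2K ℂ c₀ c R' (SSinv f))) b =
        Complex.exp (κc * (χ (bpos b) : ℂ)) • covDeriv c R (fun x => Complex.exp (-(κc * (χ x : ℂ))) • g x) b -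
          Complex.exp (κc * (χ (bpos b) : ℂ)) • covDeriv c R' (fun x => Complex.exp (-(κc * (χ x : ℂ))) • g x) b := by
    intro b
    have hx : (WL2.equiv ℂ (fun _ : TSite d Pd => c₀) W (SSinv f)) = fun x => Complex.exp (-(κc * (χ x : ℂ))) • g x := funext fun x => hSSinv f x
    rw [WL2.equiv_sub, Pi.sub_apply, hSB, hSB, B11Eq103H1Complex.equiv_covDerivL2K, B11Eq103H1Complex.equiv_covDerivL2K, hx]
  have hsq : ‖SB (covDerivL2K ℂ c₀ c R (SSinv f)) - SB (covDerivL2K ℂ c₀ c R' (SSinv f))‖ ^ 2 ≤ (K * Real.sqrt d * ‖f‖) ^ 2 := by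
    rw [WL2.norm_sq, mul_pow, mul_pow, Real.sq_sqrt (Nat.cast_nonneg d), WL2.norm_sq f]
    simp only [e]
    rw [← mul_sum, ← mul_sum]
    calc c₀ * ∑ b : Bond d Pd, ‖Complex.exp (κc * (χ (bpos b) : ℂ)) • covDeriv c R (fun x => Complex.exp (-(κc * (χ x : ℂ))) • g x) b -
            Complex.exp (κc * (χ (bpos b) : ℂ)) • covDeriv c R' (fun x => Complex.exp (-(κc * (χ x : ℂ))) • g x) b‖ ^ 2
        ≤ c₀ * (K ^ 2 * d * ∑ x, ‖g x‖ ^ 2) := mul_le_mul_of_nonneg_left hsum hc₀.le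
      _ = K ^ 2 * d * (c₀ * ∑ x, ‖g x‖ ^ 2) := by ring
  have hR0 : 0 ≤ K * Real.sqrt d * ‖f‖ := by positivity
  calc _ ≤ K * Real.sqrt d * ‖f‖ := (pow_le_pow_iff_left₀ (norm_nonneg _) hR0 two_ne_zero).1 hsq
    _ = ‖c‖ * Real.exp (‖κc‖ * θ) * δT * Real.sqrt d * ‖f‖ := by rw [hK]

end L2

end Literature.MathematicalPhysics.QuantumFieldTheory.Balaban1983to89.B9Eq3101ConjugationLettersTwoBackgroundsAdjoint

end
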